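import Mathlib.Tactic.Linarith
import Summits.CriticalPhenomena.PercolationContinuityZ3.Theorems.PercNearOneGluingNoHeavyLowerTailSahiCTCReduction
import Summits.CriticalPhenomena.PercolationContinuityZ3.Theorems.PercNearOneGluingNoHeavyLowerTailSahiCTCAllLiveCOne
import HarnessLib

/-!
# `NoHeavyLowerTail` (crux stmt-CriticalPhenomena-4575), P3 lane: the generic form `PARA₂(P, Q)` and its four REDUCTION MOVES (memo g17 §1.4,
# corrected to general complexes), as polynomial identities with nonnegative brackets

Support file (seat `prim-l12-p3`, gen 18; `--supports stmt-CriticalPhenomena-4575`).  Companions `…SahiCTCForms/FormsEdgeMove/Reduction/AllLiveCOne`.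
`PARA₂` is the fourth open all-live form of the c = 2 programme (g9 §7.2, g11 §5.1; engine term list `forms.py PARA2`):
  `PARA₂(K_X,K_Z) = e₂·Π²·h_Y − e₂·Π·X_{≤1}·h_Z + e₂·Π·X_{≥2}·t_Z + D₁·Π·e₂·Y_{≤1} − D₁·Π·Θ₁·E_Y − D₁·e₂·C_X·C_Z`
(`h_Y` = common faces of size ≤ 2, `X_{≤1}`/`X_{≥2}` = X-faces of size ≤ 1 / ≥ 2, `h_Z`/`t_Z` = Z-faces of size ≤ 2 / ≥ 3, `D₁` = sets of size ≥ 2, `Y_{≤1}` = common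
faces of size ≤ 1, `E_Y` = common edges, `C_X = GF(K_X)`, `C_Z = GF(K_Z)`).  MOVES (each verified against the engine on > 300 (pair, profile, move) instances,
code/gen18/para2_moves_test.py; the brackets below are the GENERAL ones — memo g17 §1.4 printed their all-live specialisations):
* `para2_erase_X` : removing from `K_X` a set `R ∈ K_X` that is not a common face of size ≤ 2 (any `#R ≥ 3`, or `#R = 2 ∧ R ∉ K_Z`) adds
  `e₂·r^R·(D₁·h_Z − Θ₁·t_Z)`; when `K_Z` contains every set of size ≤ 1 this is `e₂·r^R·(Θ₁·(D₁ − t_Z) + D₁·E_Z)`, coefficientwise ≥ 0 (`coeff_para2_le_erase_X`);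
* `para2_erase_Zface` : removing `F ∈ K_Z` with `#F ≥ 3` adds `e₂·r^F·(D₁·X_{≤1} − Θ₁·X_{≥2})` (≥ 0 by weighted LYM for the down-set `K_X` — manifest, and proved
  here, when `K_X` contains every set of size ≤ 1: `= e₂·r^F·Θ₁·(D₁ − X_{≥2})`, `coeff_para2_le_erase_Zface`);
* `para2_erase_Zedge` : removing an edge `a ∈ K_Z` with `a ∉ K_X` adds `e₂·r^a·(Π·X_{≤1} + D₁·C_X)`, manifestly ≥ 0 (`coeff_para2_le_erase_Zedge`, no hypothesis).
So, as for the G-forms, nonnegativity of `PARA₂` may be proved on flag pairs without common non-edges (plus X-dead points, g17 §10).  Nothing is asserted about the crux.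
-/

namespace Summit.CriticalPhenomena.PercolationContinuityZ3.Theorems.SahiCTCForms

open Finset MvPolynomial SahiCTCGenFun

variable {α : Type*} [DecidableEq α] [Fintype α]

/-- **The generic form `PARA₂(K_X, K_Z)`** (g11 §5.1 / engine `forms.py PARA2`). [this work] -/
noncomputable def PARA2 (KX KZ : Finset (Finset α)) : MvPolynomial α ℤ :=
  ee 2 * PiP * PiP * gf (smallCommonFaces KX KZ) - ee 2 * PiP * gf (faces1 KX) * gf (smallFaces KZ)
    + ee 2 * PiP * gf (faces2up KX) * gf (bigFaces KZ) + D1 * PiP * ee 2 * gf (commonFaces1 KX KZ)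
    - D1 * PiP * Th1 * gf (commonEdges KX KZ) - D1 * ee 2 * gf KX * gf KZ

omit [Fintype α] in
/-- Erasing a member splits a generating function. [this work] -/
theorem gf_erase_add {F : Finset (Finset α)} {S : Finset α} (h : S ∈ F) : gf F = gf (F.erase S) + monomial (ind S) 1 := by
  unfold gf; rw [← Finset.sum_erase_add _ _ h]

/-! ### X-move -/

/-- Removing `R` (not a common face of size ≤ 2) from `K_X`: which families change. [this work] -/
theorem X_families_erase {KX KZ : Finset (Finset α)} {R : Finset α} (hR : R ∈ KX) (hR2 : 3 ≤ #R ∨ (#R = 2 ∧ R ∉ KZ)) :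
    smallCommonFaces (KX.erase R) KZ = smallCommonFaces KX KZ ∧ faces1 (KX.erase R) = faces1 KX ∧
    commonFaces1 (KX.erase R) KZ = commonFaces1 KX KZ ∧ commonEdges (KX.erase R) KZ = commonEdges KX KZ ∧
    (faces2up (KX.erase R) = (faces2up KX).erase R ∧ R ∈ faces2up KX) := by
  have h2 : 2 ≤ #R := by omega
  refine ⟨?_, ?_, ?_, ?_, ?_, ?_⟩
  · ext S; simp only [smallCommonFaces, mem_filter, mem_erase, ne_eq]
    constructor
    · rintro ⟨h1, h2', ⟨_, hX⟩, hZ⟩; exact ⟨h1, h2', hX, hZ⟩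
    · rintro ⟨h1, h2', hX, hZ⟩
      refine ⟨h1, h2', ⟨?_, hX⟩, hZ⟩
      rintro rfl; rcases hR2 with h | ⟨_, h⟩
      · omega
      · exact h hZ
  · ext S; simp only [faces1, mem_filter, mem_erase, ne_eq]
    constructor
    · rintro ⟨h1, h2', _, hX⟩; exact ⟨h1, h2', hX⟩
    · rintro ⟨h1, h2', hX⟩; exact ⟨h1, h2', ⟨by rintro rfl; omega, hX⟩⟩
  · ext S; simp only [commonFaces1, mem_filter, mem_erase, ne_eq]
    constructor
    · rintro ⟨h1, h2', ⟨_, hX⟩, hZ⟩; exact ⟨h1, h2', hX, hZ⟩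
    · rintro ⟨h1, h2', hX, hZ⟩; exact ⟨h1, h2', ⟨by rintro rfl; omega, hX⟩, hZ⟩
  · ext S; simp only [commonEdges, mem_filter, mem_erase, ne_eq]
    constructor
    · rintro ⟨h1, h2', ⟨_, hX⟩, hZ⟩; exact ⟨h1, h2', hX, hZ⟩
    · rintro ⟨h1, h2', hX, hZ⟩
      refine ⟨h1, h2', ⟨?_, hX⟩, hZ⟩
      rintro rfl; rcases hR2 with h | ⟨_, h⟩
      · omega
      · exact h hZ
  · ext S; simp only [faces2up, mem_filter, mem_erase, ne_eq]; tauto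
  · exact mem_filter.2 ⟨mem_powerset.2 (subset_univ _), h2, hR⟩

/-- `C_K = h_K + t_K` (faces of size ≤ 2 and ≥ 3) for any family. [this work] -/
theorem gf_eq_small_add_big (K : Finset (Finset α)) : gf K = gf (smallFaces K) + gf (bigFaces K) := by
  have hU : K = smallFaces K ∪ bigFaces K := by
    ext S; simp only [smallFaces, bigFaces, mem_filter, mem_union, mem_powerset]
    constructor
    · intro h; rcases Nat.lt_or_ge #S 3 with h' | h'
      · exact Or.inl ⟨subset_univ _, by omega, h⟩
      · exact Or.inr ⟨subset_univ _, h', h⟩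
    · rintro (⟨_, _, h⟩ | ⟨_, _, h⟩) <;> exact h
  have hdj : Disjoint (smallFaces K) (bigFaces K) := by
    rw [disjoint_left]; intro S hS1 hS2; simp only [smallFaces, bigFaces, mem_filter] at hS1 hS2; omega
  rw [← gf_union hdj, ← hU]

/-- **X-move for `PARA₂`**: removing `R ∈ K_X` (`#R ≥ 3`, or an edge not in `K_Z`) adds `e₂·r^R·(D₁·h_Z − Θ₁·t_Z)`. [this work] -/
theorem para2_erase_X {KX KZ : Finset (Finset α)} {R : Finset α} (hR : R ∈ KX) (hR2 : 3 ≤ #R ∨ (#R = 2 ∧ R ∉ KZ)) :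
    PARA2 (KX.erase R) KZ = PARA2 KX KZ + ee 2 * monomial (ind R) 1 * (D1 * gf (smallFaces KZ) - Th1 * gf (bigFaces KZ)) := by
  obtain ⟨h1, h2, h3, h4, h5, h6⟩ := X_families_erase (KZ := KZ) hR hR2
  have hA : gf (faces2up KX) = gf (faces2up (KX.erase R)) + monomial (ind R) 1 := by rw [h5]; exact gf_erase_add h6
  have hB : gf KX = gf (KX.erase R) + monomial (ind R) 1 := gf_erase_add hR
  have hPi := PiP_eq_Th1_D1 (α := α)
  have hCZ := gf_eq_small_add_big KZ
  unfold PARA2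
  rw [h1, h2, h3, h4, hA, hB, hPi, hCZ]
  ring

/-- When `K_Z` contains every set of size ≤ 1, the X-bracket equals `Θ₁·GF(≥2-sets that are not Z-faces of size ≥ 3) + D₁·E_Z` and has nonnegative
coefficients. [this work] -/
theorem coeff_Xbracket_nonneg {KZ : Finset (Finset α)} (hZ1 : ∀ S : Finset α, #S ≤ 1 → S ∈ KZ) (n : α →₀ ℕ) :
    0 ≤ (D1 * gf (smallFaces KZ) - Th1 * gf (bigFaces KZ) : MvPolynomial α ℤ).coeff n := by
  have hh : gf (smallFaces KZ) = (Th1 : MvPolynomial α ℤ) + gf (edgesOf KZ) := gf_smallFaces_eq hZ1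
  have hD : (D1 : MvPolynomial α ℤ) = gf (bigFaces KZ) + gf (univ.powerset.filter fun S => 2 ≤ #S ∧ ¬ (3 ≤ #S ∧ S ∈ KZ)) := by
    have hU : (bySize (2 ≤ ·) : Finset (Finset α)) = bigFaces KZ ∪ (univ.powerset.filter fun S => 2 ≤ #S ∧ ¬ (3 ≤ #S ∧ S ∈ KZ)) := by
      ext S; simp only [bySize, bigFaces, mem_filter, mem_union]
      constructor
      · rintro ⟨hS, h2⟩
        by_cases h : 3 ≤ #S ∧ S ∈ KZ
        · exact Or.inl ⟨hS, h.1, h.2⟩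
        · exact Or.inr ⟨hS, h2, h⟩
      · rintro (⟨hS, h3, _⟩ | ⟨hS, h2, _⟩)
        · exact ⟨hS, by omega⟩
        · exact ⟨hS, h2⟩
    have hdj : Disjoint (bigFaces KZ) (univ.powerset.filter fun S => 2 ≤ #S ∧ ¬ (3 ≤ #S ∧ S ∈ KZ)) := by
      rw [disjoint_left]; intro S hS1 hS2; simp only [bigFaces, mem_filter] at hS1 hS2; exact hS2.2.2 ⟨hS1.2.1, hS1.2.2⟩
    unfold D1; rw [hU, gf_union hdj]
  have key : (D1 * gf (smallFaces KZ) - Th1 * gf (bigFaces KZ) : MvPolynomial α ℤ) =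
      Th1 * gf (univ.powerset.filter fun S => 2 ≤ #S ∧ ¬ (3 ≤ #S ∧ S ∈ KZ)) + D1 * gf (edgesOf KZ) := by
    rw [hh, hD]; ring
  rw [key, coeff_add]
  unfold Th1 D1
  have a := coeff_mul_nonneg (coeff_gf_nonneg (bySize (· ≤ 1) : Finset (Finset α)))
    (coeff_gf_nonneg (univ.powerset.filter fun S => 2 ≤ #S ∧ ¬ (3 ≤ #S ∧ S ∈ KZ))) n
  have b := coeff_mul_nonneg (coeff_gf_nonneg (bySize (2 ≤ ·) : Finset (Finset α))) (coeff_gf_nonneg (edgesOf KZ)) n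
  linarith

/-- **X-move monotonicity**: with `K_Z` containing all sets of size ≤ 1 (`Q` spanning), removing `R` from `K_X` raises `PARA₂` coefficientwise. [this work] -/
theorem coeff_para2_le_erase_X {KX KZ : Finset (Finset α)} (hZ1 : ∀ S : Finset α, #S ≤ 1 → S ∈ KZ) {R : Finset α} (hR : R ∈ KX)
    (hR2 : 3 ≤ #R ∨ (#R = 2 ∧ R ∉ KZ)) (n : α →₀ ℕ) : (PARA2 KX KZ).coeff n ≤ (PARA2 (KX.erase R) KZ).coeff n := by
  rw [para2_erase_X hR hR2, coeff_add, mul_assoc]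
  have hM := coeff_monomial_mul_nonneg R (coeff_Xbracket_nonneg hZ1)
  have := coeff_mul_nonneg (P := ee 2) (fun m => by unfold ee; exact coeff_gf_nonneg _ m) hM n
  linarith

/-! ### Z-moves -/

/-- Removing a face `F ∈ K_Z` with `#F ≥ 3`: which families change. [this work] -/
theorem Zface_families_erase {KX KZ : Finset (Finset α)} {F : Finset α} (hF : F ∈ KZ) (hF3 : 3 ≤ #F) :
    smallCommonFaces KX (KZ.erase F) = smallCommonFaces KX KZ ∧ smallFaces (KZ.erase F) = smallFaces KZ ∧
    commonFaces1 KX (KZ.erase F) = commonFaces1 KX KZ ∧ commonEdges KX (KZ.erase F) = commonEdges KX KZ ∧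
    (bigFaces (KZ.erase F) = (bigFaces KZ).erase F ∧ F ∈ bigFaces KZ) := by
  refine ⟨?_, ?_, ?_, ?_, ?_, ?_⟩
  · ext S; simp only [smallCommonFaces, mem_filter, mem_erase, ne_eq]
    constructor
    · rintro ⟨h1, h2, hX, _, hZ⟩; exact ⟨h1, h2, hX, hZ⟩
    · rintro ⟨h1, h2, hX, hZ⟩; exact ⟨h1, h2, hX, ⟨by rintro rfl; omega, hZ⟩⟩
  · ext S; simp only [smallFaces, mem_filter, mem_erase, ne_eq]
    constructor
    · rintro ⟨h1, h2, _, hZ⟩; exact ⟨h1, h2, hZ⟩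
    · rintro ⟨h1, h2, hZ⟩; exact ⟨h1, h2, ⟨by rintro rfl; omega, hZ⟩⟩
  · ext S; simp only [commonFaces1, mem_filter, mem_erase, ne_eq]
    constructor
    · rintro ⟨h1, h2, hX, _, hZ⟩; exact ⟨h1, h2, hX, hZ⟩
    · rintro ⟨h1, h2, hX, hZ⟩; exact ⟨h1, h2, hX, ⟨by rintro rfl; omega, hZ⟩⟩
  · ext S; simp only [commonEdges, mem_filter, mem_erase, ne_eq]
    constructor
    · rintro ⟨h1, h2, hX, _, hZ⟩; exact ⟨h1, h2, hX, hZ⟩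
    · rintro ⟨h1, h2, hX, hZ⟩; exact ⟨h1, h2, hX, ⟨by rintro rfl; omega, hZ⟩⟩
  · ext S; simp only [bigFaces, mem_filter, mem_erase, ne_eq]; tauto
  · exact mem_filter.2 ⟨mem_powerset.2 (subset_univ _), hF3, hF⟩

/-- `C_K = X_{≤1} + X_{≥2}` for any family. [this work] -/
theorem gf_eq_faces1_add_faces2up (K : Finset (Finset α)) : gf K = gf (faces1 K) + gf (faces2up K) := by
  have hU : K = faces1 K ∪ faces2up K := by
    ext S; simp only [faces1, faces2up, mem_filter, mem_union, mem_powerset]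
    constructor
    · intro h; rcases Nat.lt_or_ge #S 2 with h' | h'
      · exact Or.inl ⟨subset_univ _, by omega, h⟩
      · exact Or.inr ⟨subset_univ _, h', h⟩
    · rintro (⟨_, _, h⟩ | ⟨_, _, h⟩) <;> exact h
  have hdj : Disjoint (faces1 K) (faces2up K) := by
    rw [disjoint_left]; intro S hS1 hS2; simp only [faces1, faces2up, mem_filter] at hS1 hS2; omega
  rw [← gf_union hdj, ← hU]

/-- **Z-face move for `PARA₂`**: removing `F ∈ K_Z` with `#F ≥ 3` adds `e₂·r^F·(D₁·X_{≤1} − Θ₁·X_{≥2})`. [this work] -/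
theorem para2_erase_Zface {KX KZ : Finset (Finset α)} {F : Finset α} (hF : F ∈ KZ) (hF3 : 3 ≤ #F) :
    PARA2 KX (KZ.erase F) = PARA2 KX KZ + ee 2 * monomial (ind F) 1 * (D1 * gf (faces1 KX) - Th1 * gf (faces2up KX)) := by
  obtain ⟨h1, h2, h3, h4, h5, h6⟩ := Zface_families_erase (KX := KX) hF hF3
  have hA : gf (bigFaces KZ) = gf (bigFaces (KZ.erase F)) + monomial (ind F) 1 := by rw [h5]; exact gf_erase_add h6
  have hB : gf KZ = gf (KZ.erase F) + monomial (ind F) 1 := gf_erase_add hF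
  have hPi := PiP_eq_Th1_D1 (α := α)
  have hCX := gf_eq_faces1_add_faces2up KX
  unfold PARA2
  rw [h1, h2, h3, h4, hA, hB, hCX, hPi]
  ring

/-- When `K_X` contains every set of size ≤ 1, the Z-face bracket is `Θ₁·t̄⁽¹⁾_X` (nonnegative coefficients).  (In general it is `D₁·X_{≤1} − Θ₁·X_{≥2} ≥ 0`
by weighted LYM for the down-set `K_X`; not formalised here.) [this work] -/
theorem coeff_Zface_bracket_nonneg {KX : Finset (Finset α)} (hX1 : ∀ S : Finset α, #S ≤ 1 → S ∈ KX) (n : α →₀ ℕ) :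
    0 ≤ (D1 * gf (faces1 KX) - Th1 * gf (faces2up KX) : MvPolynomial α ℤ).coeff n := by
  obtain ⟨hf1, hD⟩ := allLive_c1 hX1
  have key : (D1 * gf (faces1 KX) - Th1 * gf (faces2up KX) : MvPolynomial α ℤ) = Th1 * gf (nonFaces2up KX) := by
    rw [hf1, hD]; ring
  rw [key]; unfold Th1
  exact coeff_mul_nonneg (coeff_gf_nonneg _) (coeff_gf_nonneg _) n

/-- **Z-face move monotonicity** (with `K_X` containing all sets of size ≤ 1). [this work] -/
theorem coeff_para2_le_erase_Zface {KX KZ : Finset (Finset α)} (hX1 : ∀ S : Finset α, #S ≤ 1 → S ∈ KX) {F : Finset α} (hF : F ∈ KZ)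
    (hF3 : 3 ≤ #F) (n : α →₀ ℕ) : (PARA2 KX KZ).coeff n ≤ (PARA2 KX (KZ.erase F)).coeff n := by
  rw [para2_erase_Zface hF hF3, coeff_add, mul_assoc]
  have hM := coeff_monomial_mul_nonneg F (coeff_Zface_bracket_nonneg hX1)
  have := coeff_mul_nonneg (P := ee 2) (fun m => by unfold ee; exact coeff_gf_nonneg _ m) hM n
  linarith

/-- Removing an edge `a ∈ K_Z` with `a ∉ K_X`: which families change. [this work] -/
theorem Zedge_families_erase {KX KZ : Finset (Finset α)} {a : Finset α} (haZ : a ∈ KZ) (haX : a ∉ KX) (ha : #a = 2) :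
    smallCommonFaces KX (KZ.erase a) = smallCommonFaces KX KZ ∧ bigFaces (KZ.erase a) = bigFaces KZ ∧
    commonFaces1 KX (KZ.erase a) = commonFaces1 KX KZ ∧ commonEdges KX (KZ.erase a) = commonEdges KX KZ ∧
    (smallFaces (KZ.erase a) = (smallFaces KZ).erase a ∧ a ∈ smallFaces KZ) := by
  refine ⟨?_, ?_, ?_, ?_, ?_, ?_⟩
  · ext S; simp only [smallCommonFaces, mem_filter, mem_erase, ne_eq]
    constructor
    · rintro ⟨h1, h2, hX, _, hZ⟩; exact ⟨h1, h2, hX, hZ⟩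
    · rintro ⟨h1, h2, hX, hZ⟩; exact ⟨h1, h2, hX, ⟨by rintro rfl; exact haX hX, hZ⟩⟩
  · ext S; simp only [bigFaces, mem_filter, mem_erase, ne_eq]
    constructor
    · rintro ⟨h1, h3, _, hZ⟩; exact ⟨h1, h3, hZ⟩
    · rintro ⟨h1, h3, hZ⟩; exact ⟨h1, h3, ⟨by rintro rfl; omega, hZ⟩⟩
  · ext S; simp only [commonFaces1, mem_filter, mem_erase, ne_eq]
    constructor
    · rintro ⟨h1, h2, hX, _, hZ⟩; exact ⟨h1, h2, hX, hZ⟩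
    · rintro ⟨h1, h2, hX, hZ⟩; exact ⟨h1, h2, hX, ⟨by rintro rfl; exact haX hX, hZ⟩⟩
  · ext S; simp only [commonEdges, mem_filter, mem_erase, ne_eq]
    constructor
    · rintro ⟨h1, h2, hX, _, hZ⟩; exact ⟨h1, h2, hX, hZ⟩
    · rintro ⟨h1, h2, hX, hZ⟩; exact ⟨h1, h2, hX, ⟨by rintro rfl; exact haX hX, hZ⟩⟩
  · ext S; simp only [smallFaces, mem_filter, mem_erase, ne_eq]; tauto
  · exact mem_filter.2 ⟨mem_powerset.2 (subset_univ _), by omega, haZ⟩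

/-- **Z-edge move for `PARA₂`**: removing an edge `a ∈ K_Z`, `a ∉ K_X` adds `e₂·r^a·(Π·X_{≤1} + D₁·C_X)` (manifestly nonnegative). [this work] -/
theorem para2_erase_Zedge {KX KZ : Finset (Finset α)} {a : Finset α} (haZ : a ∈ KZ) (haX : a ∉ KX) (ha : #a = 2) :
    PARA2 KX (KZ.erase a) = PARA2 KX KZ + ee 2 * monomial (ind a) 1 * (PiP * gf (faces1 KX) + D1 * gf KX) := by
  obtain ⟨h1, h2, h3, h4, h5, h6⟩ := Zedge_families_erase haZ haX ha
  have hA : gf (smallFaces KZ) = gf (smallFaces (KZ.erase a)) + monomial (ind a) 1 := by rw [h5]; exact gf_erase_add h6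
  have hB : gf KZ = gf (KZ.erase a) + monomial (ind a) 1 := gf_erase_add haZ
  unfold PARA2
  rw [h1, h2, h3, h4, hA, hB]
  ring

/-- **Z-edge move monotonicity** (no hypothesis). [this work] -/
theorem coeff_para2_le_erase_Zedge {KX KZ : Finset (Finset α)} {a : Finset α} (haZ : a ∈ KZ) (haX : a ∉ KX) (ha : #a = 2) (n : α →₀ ℕ) :
    (PARA2 KX KZ).coeff n ≤ (PARA2 KX (KZ.erase a)).coeff n := by
  rw [para2_erase_Zedge haZ haX ha, coeff_add, mul_assoc]
  have hB : ∀ m, 0 ≤ (PiP * gf (faces1 KX) + D1 * gf KX : MvPolynomial α ℤ).coeff m := fun m => by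
    rw [coeff_add]; unfold PiP D1
    have a1 := coeff_mul_nonneg (coeff_gf_nonneg (univ.powerset : Finset (Finset α))) (coeff_gf_nonneg (faces1 KX)) m
    have a2 := coeff_mul_nonneg (coeff_gf_nonneg (bySize (2 ≤ ·) : Finset (Finset α))) (coeff_gf_nonneg KX) m
    linarith
  have hM := coeff_monomial_mul_nonneg a hB
  have := coeff_mul_nonneg (P := ee 2) (fun m => by unfold ee; exact coeff_gf_nonneg _ m) hM n
  linarith

end Summit.CriticalPhenomena.PercolationContinuityZ3.Theorems.SahiCTCForms
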